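import Literature.Probability.LatticeModels.RCBoxGraph
import Literature.Probability.LatticeModels.RandomClusterFKG
import HarnessLib

/-!
# Random-cluster contours, XIII: box measures versus contour-volume weights

Topic `Literature/Probability/LatticeModels`. The measure-theoretic half of the dictionary of `RCBoxGraph`:
the ratio `Σ_{ω̃ : P} wt(ω̃) / Z^σ(Λ_{M+2})` of contour-volume weights (`RCRepresentation.wt`, `RCWeights.Zrc`) over
the configurations of the free edges of the box `Λ_{M+2}` satisfying a property `P` **is** the probability, under
the finite-graph random-cluster measure `rcMeasure` (Grimmett 2006, (1.2), (4.11)–(4.12)) of the spine graph of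
`Λ_M` — wired on `∂Λ_M` for `σ = ord`, free for `σ = dis` — of the lifted event (`sum_wt_filter_div_eq_rcMeasure`;
`t² = p/(1-p)`): the weights are proportional (`wt_image_liftE`, constant `spineC`), by the energy and
cluster-count transfer of `RCBoxGraph`. Two general facts about `rcMeasure` used on the way to the box measures of
the barrier file: events agreeing on the edge sets have the same probability (`rcMeasure_real_eq_of_iff`), and
**edges with both endpoints in the wired set are irrelevant** (`rcMeasure_real_eq_of_le_of_wired`: deleting them
does not change the probability of events not depending on them — Grimmett's remark that under the wired boundary
condition the states of the edges inside the wired part do not matter), plus `rcMeasure_congr` (equal graphs).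

Everything is proved; no named facts.

## References

* G. Grimmett, *The Random-Cluster Model*, Springer 2006, §1.2 eq. (1.2), Thm. (3.1)(a), §4.2 (4.11)–(4.13). [Grimmett2006]
* S. Friedli, Y. Velenik, *Statistical Mechanics of Lattice Systems*, CUP 2017, §7.3, Lemma 7.20 (Ω^#_Λ). [FriedliVelenik2017]
-/

noncomputable section

open Finset Relation MeasureTheory

namespace Literature.Probability.LatticeModels

/-! ### 1. Two general facts about the finite-graph random-cluster measure -/

section General

variable {W : Type*} [Fintype W] [DecidableEq W]

/-- Sums over the subsets of a disjoint union, as double sums (a private copy of the identically named lemma of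
`CurrentsAvoidMixing`, to keep the import closure small). [folklore] -/
private theorem sum_powerset_union_eq_sum_sum {β : Type*} [DecidableEq β] {E E' : Finset β} (h : Disjoint E E') (g : Finset β → ℝ) :
    ∑ U ∈ (E ∪ E').powerset, g U = ∑ A ∈ E.powerset, ∑ B ∈ E'.powerset, g (A ∪ B) := by
  rw [← sum_product' (f := fun A B => g (A ∪ B))]
  refine sum_nbij' (fun U => (U ∩ E, U ∩ E')) (fun p => p.1 ∪ p.2) (fun U _ => ?_) (fun p hp => ?_)
    (fun U hU => ?_) (fun p hp => ?_) (fun U hU => ?_)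
  · exact mem_product.2 ⟨mem_powerset.2 inter_subset_right, mem_powerset.2 inter_subset_right⟩
  · obtain ⟨h1, h2⟩ := mem_product.1 hp
    exact mem_powerset.2 (union_subset_union (mem_powerset.1 h1) (mem_powerset.1 h2))
  · show U ∩ E ∪ U ∩ E' = U
    rw [← inter_union_distrib_left]; exact inter_eq_left.2 (mem_powerset.1 hU)
  · obtain ⟨h1, h2⟩ := mem_product.1 hp
    have h1' := mem_powerset.1 h1; have h2' := mem_powerset.1 h2
    refine Prod.ext ?_ ?_
    · show (p.1 ∪ p.2) ∩ E = p.1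
      rw [union_inter_distrib_right, inter_eq_left.2 h1', disjoint_iff_inter_eq_empty.1 (h.symm.mono_left h2'), union_empty]
    · show (p.1 ∪ p.2) ∩ E' = p.2
      rw [union_inter_distrib_right, inter_eq_left.2 h2', disjoint_iff_inter_eq_empty.1 (h.mono_left h1'), empty_union]
  · show g U = g (U ∩ E ∪ U ∩ E')
    rw [← inter_union_distrib_left, inter_eq_left.2 (mem_powerset.1 hU)]

/-- **Events agreeing on the edge sets of the graph have the same probability.** [cite: Grimmett2006, §1.2 (φ lives on Ω_E)] -/
theorem rcMeasure_real_eq_of_iff (H : SimpleGraph W) [DecidableRel H.Adj] {p q : ℝ} (hp : p ∈ Set.Icc (0 : ℝ) 1) (hq : 0 < q)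
    (B : Set W) {A A' : Set (Percolation.BondConfig W)}
    (h : ∀ ω : Finset (Sym2 W), ω ⊆ H.edgeFinset → ((↑ω : Percolation.BondConfig W) ∈ A ↔ (↑ω : Percolation.BondConfig W) ∈ A')) :
    (rcMeasure H p q B).real A = (rcMeasure H p q B).real A' := by
  classical
  rw [rcMeasure_real_apply H hp hq B A, rcMeasure_real_apply H hp hq B A']
  refine sum_congr rfl fun ω hω => ?_
  rw [h ω (mem_powerset.1 hω)]

/-- **Edges with both endpoints wired are irrelevant.** Let `H₂ ≤ H₁` be graphs on the same finite vertex type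
whose difference consists of edges with both endpoints in the wired set `B`. Then every event that does not
depend on these edges has the same probability under `φ^B_{H₁,p,q}` and `φ^B_{H₂,p,q}`: opening such an edge changes
neither the cluster count nor, after summing over its two states, the weight.
[cite: Grimmett2006, §4.2 (wired boundary condition: edges inside the wired part) and Thm. (3.1)(a)] -/
theorem rcMeasure_real_eq_of_le_of_wired (H₁ H₂ : SimpleGraph W) [DecidableRel H₁.Adj] [DecidableRel H₂.Adj] (hle : H₂ ≤ H₁)
    {p q : ℝ} (hp : p ∈ Set.Icc (0 : ℝ) 1) (hq : 0 < q) (B : Set W)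
    (hB : ∀ e ∈ H₁.edgeFinset \ H₂.edgeFinset, ∀ z ∈ e, z ∈ B)
    {A : Set (Percolation.BondConfig W)}
    (hA : ∀ ω : Finset (Sym2 W), ω ⊆ H₁.edgeFinset → ((↑ω : Percolation.BondConfig W) ∈ A ↔ (↑(ω ∩ H₂.edgeFinset) : Percolation.BondConfig W) ∈ A)) :
    (rcMeasure H₁ p q B).real A = (rcMeasure H₂ p q B).real A := by
  classical
  set E₁ := H₁.edgeFinset with hE₁
  set E₂ := H₂.edgeFinset with hE₂
  set Eb := E₁ \ E₂ with hEb
  have hsub : E₂ ⊆ E₁ := fun e he => by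
    rw [hE₂, SimpleGraph.mem_edgeFinset] at he; rw [hE₁, SimpleGraph.mem_edgeFinset]; exact SimpleGraph.edgeSet_mono hle he
  have hunion : E₁ = E₂ ∪ Eb := (union_sdiff_of_subset hsub).symm
  have hdisj : Disjoint E₂ Eb := disjoint_sdiff
  -- the cluster count ignores the wired edges
  have hcc : ∀ ω₂ ⊆ E₂, ∀ ωb ⊆ Eb, clusterCount (↑(ω₂ ∪ ωb) : Percolation.BondConfig W) B = clusterCount (↑ω₂ : Percolation.BondConfig W) B := by
    intro ω₂ _ ωb hωb
    unfold clusterCount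
    have hG : Percolation.openGraph (↑(ω₂ ∪ ωb) : Percolation.BondConfig W) ⊔ wired B = Percolation.openGraph (↑ω₂ : Percolation.BondConfig W) ⊔ wired B := by
      ext x y
      simp only [SimpleGraph.sup_adj, Percolation.openGraph_adj, wired_adj, mem_coe, coe_union, Set.mem_union]
      constructor
      · rintro (⟨h | h, hne⟩ | h)
        · exact Or.inl ⟨h, hne⟩
        · exact Or.inr ⟨hne, hB _ (hωb h) x (Sym2.mem_mk_left x y), hB _ (hωb h) y (Sym2.mem_mk_right x y)⟩
        · exact Or.inr h
      · rintro (⟨h, hne⟩ | h)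
        · exact Or.inl ⟨Or.inl h, hne⟩
        · exact Or.inr h
    rw [hG]
  -- the weight factorises
  have hw : ∀ ω₂ ⊆ E₂, ∀ ωb ⊆ Eb, rcWeight H₁ p q B (ω₂ ∪ ωb) = rcWeight H₂ p q B ω₂ * (p ^ #ωb * (1 - p) ^ (#Eb - #ωb)) := by
    intro ω₂ hω₂ ωb hωb
    have hd : Disjoint ω₂ ωb := hdisj.mono hω₂ hωb
    have hsd : E₁ \ (ω₂ ∪ ωb) = (E₂ \ ω₂) ∪ (Eb \ ωb) := by
      ext e; simp only [mem_sdiff, mem_union, hunion]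
      constructor
      · rintro ⟨h1 | h1, h2⟩
        · exact Or.inl ⟨h1, fun h => h2 (Or.inl h)⟩
        · exact Or.inr ⟨h1, fun h => h2 (Or.inr h)⟩
      · rintro (⟨h1, h2⟩ | ⟨h1, h2⟩)
        · exact ⟨Or.inl h1, fun h => h.elim h2 fun h' => Finset.disjoint_left.1 hdisj h1 (hωb h')⟩
        · exact ⟨Or.inr h1, fun h => h.elim (fun h' => Finset.disjoint_left.1 hdisj (hω₂ h') h1) h2⟩
    have hd' : Disjoint (E₂ \ ω₂) (Eb \ ωb) := hdisj.mono sdiff_subset sdiff_subset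
    rw [rcWeight, rcWeight, hcc ω₂ hω₂ ωb hωb, card_union_of_disjoint hd, ← hE₁, hsd, card_union_of_disjoint hd', ← hE₂,
      card_sdiff_of_subset hωb, pow_add, pow_add]
    ring
  have hbin : ∑ ωb ∈ Eb.powerset, p ^ #ωb * (1 - p) ^ (#Eb - #ωb) = 1 := by
    rw [Finset.sum_pow_mul_eq_add_pow, add_sub_cancel, one_pow]
  -- partition functions agree
  have hZ : rcPartitionFunction H₁ p q B = rcPartitionFunction H₂ p q B := by
    rw [rcPartitionFunction, rcPartitionFunction, ← hE₁, ← hE₂, hunion, sum_powerset_union_eq_sum_sum hdisj]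
    refine sum_congr rfl fun ω₂ hω₂ => ?_
    rw [sum_congr rfl fun ωb hωb => hw ω₂ (mem_powerset.1 hω₂) ωb (mem_powerset.1 hωb), ← mul_sum, hbin, mul_one]
  rw [rcMeasure_real_apply H₁ hp hq B A, rcMeasure_real_apply H₂ hp hq B A, ← hE₁, ← hE₂, hZ, hunion,
    sum_powerset_union_eq_sum_sum hdisj]
  refine sum_congr rfl fun ω₂ hω₂ => ?_
  have hω₂' := mem_powerset.1 hω₂
  have hind : ∀ ωb ∈ Eb.powerset, ((↑(ω₂ ∪ ωb) : Percolation.BondConfig W) ∈ A ↔ (↑ω₂ : Percolation.BondConfig W) ∈ A) := by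
    intro ωb hωb
    have hωb' := mem_powerset.1 hωb
    rw [hA (ω₂ ∪ ωb) (by rw [hunion]; exact union_subset_union hω₂' hωb')]
    have : (ω₂ ∪ ωb) ∩ E₂ = ω₂ := by
      rw [union_inter_distrib_right, inter_eq_left.2 hω₂', disjoint_iff_inter_eq_empty.1 (hdisj.symm.mono_left hωb'), union_empty]
    rw [this]
  by_cases hmem : (↑ω₂ : Percolation.BondConfig W) ∈ A
  · rw [if_pos hmem]
    have hterm : ∀ ωb ∈ Eb.powerset,
        (if (↑(ω₂ ∪ ωb) : Percolation.BondConfig W) ∈ A then rcWeight H₁ p q B (ω₂ ∪ ωb) / rcPartitionFunction H₂ p q B else 0) =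
          rcWeight H₂ p q B ω₂ / rcPartitionFunction H₂ p q B * (p ^ #ωb * (1 - p) ^ (#Eb - #ωb)) := by
      intro ωb hωb
      rw [if_pos ((hind ωb hωb).2 hmem), hw ω₂ hω₂' ωb (mem_powerset.1 hωb)]
      ring
    rw [sum_congr rfl hterm, ← mul_sum, hbin, mul_one]
  · rw [if_neg hmem]
    exact sum_eq_zero fun ωb hωb => if_neg (fun h => hmem ((hind ωb hωb).1 h))

/-- Equal graphs (with any decidability instances) have the same random-cluster measure. [folklore] -/
theorem rcMeasure_congr {H₁ H₂ : SimpleGraph W} [i₁ : DecidableRel H₁.Adj] [i₂ : DecidableRel H₂.Adj] (h : H₁ = H₂) (p q : ℝ) (B : Set W) :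
    @rcMeasure W _ _ H₁ i₁ p q B = @rcMeasure W _ _ H₂ i₂ p q B := by
  subst h
  have : i₁ = i₂ := Subsingleton.elim _ _
  subst this
  rfl

end General

/-! ### 2. The spine box: contour-volume weights are random-cluster weights -/

namespace RCC

open ContourSetup ClassCount

variable {d : ℕ}

/-- The wired set of the spine box for a boundary condition: `∂Λ_M` for `ord`, nothing for `dis`.
[cite: Grimmett2006, §4.2 (4.11)–(4.12)] -/
def spineB (d M : ℕ) (σ : Phase) : Set (↥(box d M)) := if σ = Phase.ord then wiredBoundary (zdGraph d) (box d M) else ∅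

/-- The proportionality constant between contour-volume weights and random-cluster weights.
[folklore] -/
def spineC (d M : ℕ) (t p q : ℝ) (σ : Phase) : ℝ :=
  if σ = Phase.ord then t ^ pinned (box d (M + 2)) / (q * (1 - p) ^ #(spineGraph d M).edgeFinset)
  else q ^ #(box d (M + 2) \ box d M) / (1 - p) ^ #(spineGraph d M).edgeFinset

/-- The constant is positive. [folklore] -/
theorem spineC_pos (M : ℕ) {t p q : ℝ} (ht : 0 < t) (hp : p < 1) (hq : 0 < q) (σ : Phase) : 0 < spineC d M t p q σ := by
  have h1 : 0 < 1 - p := sub_pos.2 hp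
  rw [spineC]; split_ifs
  · exact div_pos (pow_pos ht _) (mul_pos hq (pow_pos h1 _))
  · exact div_pos (pow_pos hq _) (pow_pos h1 _)

/-- **The contour-volume weight of a lifted configuration is proportional to its random-cluster weight in the
spine box** (`t² = p/(1-p)`): `wt(ωt) = C_σ · p^{|ω|}(1-p)^{|E∖ω|} q^{k^{B_σ}(ω)}`.
[cite: Grimmett2006, §1.2 eq. (1.2), §4.2 (4.12), §7.5 (7.63)–(7.66)] -/
theorem wt_image_liftE (hd : 1 ≤ d) {M : ℕ} (hM : 1 ≤ M) {t p q : ℝ} (hp : p < 1) (hq : 0 < q) (ht2 : t ^ 2 = p / (1 - p))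
    (σ : Phase) {ω' : Finset (Sym2 (↥(box d M)))} (hω' : ω' ⊆ (spineGraph d M).edgeFinset) :
    wt t q σ (box d (M + 2)) (ω'.image liftE) = spineC d M t p q σ * rcWeight (spineGraph d M) p q (spineB d M σ) ω' := by
  have h1 : 1 - p ≠ 0 := (sub_pos.2 hp).ne'
  have hq0 : q ≠ 0 := hq.ne'
  have htp : (t ^ 2) ^ #ω' * (1 - p) ^ #ω' = p ^ #ω' := by
    rw [← mul_pow, ht2, div_mul_cancel₀ _ h1]
  have hE : (1 - p) ^ #((spineGraph d M).edgeFinset \ ω') * (1 - p) ^ #ω' = (1 - p) ^ #(spineGraph d M).edgeFinset := by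
    rw [← pow_add, card_sdiff_add_card_eq_card hω']
  have hsub := image_liftE_subset hM hω'
  cases σ
  · -- `ord`
    have hk := kappa_ord_box hd hM hω'
    rw [wt, energy_ord_eq hsub, card_image_liftE, spineC, if_pos rfl, spineB, if_pos rfl, rcWeight, ← hk, pow_add, pow_add, pow_mul,
      pow_one, ← htp, ← hE, div_mul_eq_mul_div, eq_div_iff (mul_ne_zero hq0 (mul_ne_zero (pow_ne_zero _ h1) (pow_ne_zero _ h1)))]
    ring
  · -- `dis`
    have hk := kappa_dis_box hω'
    rw [wt, energy_dis_eq hsub, card_image_liftE, spineC, if_neg (by decide : Phase.dis ≠ Phase.ord), spineB,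
      if_neg (by decide : Phase.dis ≠ Phase.ord), rcWeight, hk, pow_add, pow_mul, ← htp, ← hE, div_mul_eq_mul_div,
      eq_div_iff (mul_ne_zero (pow_ne_zero _ h1) (pow_ne_zero _ h1))]
    ring

/-- The event of the spine box configurations (finite edge sets) whose lift satisfies `P`. [folklore] -/
def liftEvent (M : ℕ) (P : Finset (Sym2 (Site d)) → Prop) : Set (Percolation.BondConfig (↥(box d M))) :=
  {ω | ∃ ω' : Finset (Sym2 (↥(box d M))), (↑ω' : Percolation.BondConfig (↥(box d M))) = ω ∧ P (ω'.image liftE)}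

/-- The lifted event on finite configurations is `P` of the lift. [folklore] -/
theorem coe_mem_liftEvent_iff {M : ℕ} {P : Finset (Sym2 (Site d)) → Prop} (ω' : Finset (Sym2 (↥(box d M)))) :
    (↑ω' : Percolation.BondConfig (↥(box d M))) ∈ liftEvent M P ↔ P (ω'.image liftE) := by
  constructor
  · rintro ⟨ω'', h, hP⟩
    rw [Finset.coe_inj] at h
    subst h
    exact hP
  · exact fun h => ⟨ω', rfl, h⟩

/-- **The contour-volume probability of an event is its random-cluster probability in the spine box**
(`p ∈ (0,1)`, `t² = p/(1-p)`, `q > 0`, `M ≥ 1`):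
`Σ_{ωt : P} wt(ωt) / Z^σ(Λ_{M+2}) = φ^{B_σ}_{spine,p,q}(P ∘ lift)`.
[cite: Grimmett2006, §1.2 eq. (1.2) and §4.2 (4.11)–(4.12)] -/
theorem sum_wt_filter_div_eq_rcMeasure (hd : 1 ≤ d) {M : ℕ} (hM : 1 ≤ M) {t p q : ℝ} (ht : 0 < t) (hp : p ∈ Set.Ioo (0 : ℝ) 1) (hq : 0 < q)
    (ht2 : t ^ 2 = p / (1 - p)) (σ : Phase) (P : Finset (Sym2 (Site d)) → Prop) [DecidablePred P] :
    (∑ ωt ∈ (freeEdges (box d (M + 2))).powerset with P ωt, wt t q σ (box d (M + 2)) ωt) / Zrc t q σ (box d (M + 2)) =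
      (rcMeasure (spineGraph d M) p q (spineB d M σ)).real (liftEvent M P) := by
  classical
  have hp' : p ∈ Set.Icc (0 : ℝ) 1 := ⟨hp.1.le, hp.2.le⟩
  set C := spineC d M t p q σ with hC
  have hC0 : 0 < C := spineC_pos M ht hp.2 hq σ
  have hinj : ∀ a ∈ (spineGraph d M).edgeFinset.powerset, ∀ b ∈ (spineGraph d M).edgeFinset.powerset,
      a.image liftE = b.image liftE → a = b := fun a _ b _ h => image_injective liftE_injective h
  -- numerator and denominator as sums over the spine box
  have hnum : ∑ ωt ∈ (freeEdges (box d (M + 2))).powerset with P ωt, wt t q σ (box d (M + 2)) ωt =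
      C * ∑ ω' ∈ (spineGraph d M).edgeFinset.powerset,
        (if (↑ω' : Percolation.BondConfig (↥(box d M))) ∈ liftEvent M P then rcWeight (spineGraph d M) p q (spineB d M σ) ω' else 0) := by
    rw [sum_filter, powerset_freeEdges_eq_image hM, sum_image hinj, mul_sum]
    refine sum_congr rfl fun ω' hω' => ?_
    have hω'' := mem_powerset.1 hω'
    rw [coe_mem_liftEvent_iff ω']
    split_ifs
    · rw [wt_image_liftE hd hM hp.2 hq ht2 σ hω'']
    · rw [mul_zero]
  have hden : Zrc t q σ (box d (M + 2)) = C * rcPartitionFunction (spineGraph d M) p q (spineB d M σ) := by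
    rw [Zrc_eq_sum_wt, powerset_freeEdges_eq_image hM, sum_image hinj, rcPartitionFunction, mul_sum]
    exact sum_congr rfl fun ω' hω' => wt_image_liftE hd hM hp.2 hq ht2 σ (mem_powerset.1 hω')
  have hZ := rcPartitionFunction_pos (spineGraph d M) hp' hq (spineB d M σ)
  rw [hnum, hden, mul_div_mul_left _ _ hC0.ne', rcMeasure_real_apply (spineGraph d M) hp' hq (spineB d M σ) (liftEvent M P), sum_div]
  refine sum_congr rfl fun ω' _ => ?_
  split_ifs <;> simp

end RCC

end Literature.Probability.LatticeModels
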